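import Summits.KontsevichZagierPeriods.KontsevichZagierPeriods.Theorems.LinRedNormalFormArrangementNormalFormSeparateTwoZeroLetters

/-!
# Letters, special points and the closed cell, with fibres

(Line `janus-bands`, crux `ArrangementNormalForm`, stub `stub_separateTwoPos` — separation in a
good rational direction for planar Janus band representations WITH `k` fibres; part `Letters`.)

The planar dictionary of `stub_separateTwoZero` (part `…SeparateTwoZeroLetters`, base
`Fin (1 + 1 + 0)`) transported to the base coordinates `z (Fin.castAdd k 0)`, `z (Fin.castAdd k 1)`
of a point `z ∈ ℝ^{1+1+k}` of a Janus band domain `SeparatePos.gDom 1 k` (polygonal base cell ×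
fibres): coordinates of `x`-forms and rows (`affB_eq`, `rowval_eq`), the weak row inequalities
on the closed cell (`rows_nonneg_of_mem_closure`), separation of special points by rows
(`not_both_mem_closure`), the double cone at a special point (`cone_of_rows`), harmless walls
through far special points (`fst_sub_bounded_below`, registered as `separateTwoPos_letters`),
crossing points and walls of pairs of letters (`exists_cross`, `wall_of_near`, read off the
fibre-free statements at the base projection of the point), and the ratio condition of a far
pair from the harmlessness of its wall (`ratio_of_harmless`). The fibres only ride along: every
statement concerns the base projection.
-/

noncomputable section

open Set MeasureTheory Filter Topology

namespace Summit.KontsevichZagierPeriods.ArrangementNormalForm.JanusBands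

open Literature.NumberTheory.Transcendental

namespace SepTwoPos

open SeparatePos SepTwoZero

section Coordinates

variable {k : ℕ}

/-- An `x`-form in the base coordinates of `ℝ^{1+1+k}`. [folklore] -/
theorem affB_eq (c : (Fin 1 → ℚ) × ℚ) (z : Fin (1 + 1 + k) → ℝ) :
    affB 1 k c z = (c.1 0 : ℝ) * z (Fin.castAdd k 0) + c.2 := by
  simp [affB]

/-- A full-base form in the base coordinates of `ℝ^{1+1+k}`. [folklore] -/
theorem rowval_eq (c : (Fin (1 + 1) → ℚ) × ℚ) (z : Fin (1 + 1 + k) → ℝ) :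
    ∑ i, (c.1 i : ℝ) * z (Fin.castAdd k i) + c.2 =
      c.1 0 * z (Fin.castAdd k 0) + c.1 1 * z (Fin.castAdd k 1) + c.2 := by
  simp [Fin.sum_univ_two]

/-- The base index `y` of `Fin (1 + 1 + k)`. [folklore] -/
theorem cA1 : (Fin.castAdd k (Fin.last 1) : Fin (1 + 1 + k)) = Fin.castAdd k 1 := rfl

/-- The `x`-part of a point. [folklore] -/
theorem xpart_eq (z : Fin (1 + 1 + k) → ℝ) :
    (fun i : Fin 1 => z (Fin.castAdd k (Fin.castSucc i))) = fun _ => z (Fin.castAdd k 0) := by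
  funext i; fin_cases i; rfl

/-- A row at a point lying over a rational base point. [folklore] -/
theorem rowval_of_base (c : (Fin (1 + 1) → ℚ) × ℚ) (X : ℚ × ℚ) {z : Fin (1 + 1 + k) → ℝ}
    (hx : z (Fin.castAdd k 0) = X.1) (hy : z (Fin.castAdd k 1) = X.2) :
    ∑ i, (c.1 i : ℝ) * z (Fin.castAdd k i) + c.2 = (evq c X : ℝ) := by
  rw [rowval_eq, hx, hy]; simp [evq]

/-- A row through a rational point, recentred there. [folklore] -/
theorem rowval_sub_pt (c : (Fin (1 + 1) → ℚ) × ℚ) (X : ℚ × ℚ) (hX : evq c X = 0)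
    (z : Fin (1 + 1 + k) → ℝ) : ∑ i, (c.1 i : ℝ) * z (Fin.castAdd k i) + c.2 =
      (c.1 0 : ℝ) * (z (Fin.castAdd k 0) - X.1) + (c.1 1 : ℝ) * (z (Fin.castAdd k 1) - X.2) := by
  have h : ((c.1 0 : ℝ) * X.1 + c.1 1 * X.2 + c.2) = 0 := by exact_mod_cast hX
  rw [rowval_eq]; linear_combination h

end Coordinates

section Piece

variable {k m' : ℕ} (M : Fin m' → (Fin (1 + 1) → ℚ) × ℚ)
  (lo up : Fin k → Fin k ⊕ ((Fin (1 + 1) → ℚ) × ℚ))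

/-- Points of the closed cell satisfy the weak row inequalities. [folklore] -/
theorem rows_nonneg_of_mem_closure {z : Fin (1 + 1 + k) → ℝ}
    (hz : z ∈ closure (gDom 1 k m' M lo up)) (j : Fin m') :
    0 ≤ ∑ i, ((M j).1 i : ℝ) * z (Fin.castAdd k i) + (M j).2 := by
  refine le_of_mem_closure' (f := fun _ => (0 : ℝ))
    (g := fun z : Fin (1 + 1 + k) → ℝ => ∑ i, ((M j).1 i : ℝ) * z (Fin.castAdd k i) + (M j).2)
    continuous_const (by simp only [rowval_eq]; fun_prop) (fun z hz => (hz.1 j).le) hz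

/-- **Separation of the special points**: two rational base points separated by a row do not
both lie under the closed cell. [folklore] -/
theorem not_both_mem_closure {X X' : ℚ × ℚ} (j : Fin m') (hj : evq (M j) X * evq (M j) X' < 0)
    {z z' : Fin (1 + 1 + k) → ℝ}
    (hz : z ∈ closure (gDom 1 k m' M lo up)) (hzx : z (Fin.castAdd k 0) = X.1)
    (hzy : z (Fin.castAdd k 1) = X.2)
    (hz' : z' ∈ closure (gDom 1 k m' M lo up)) (hz'x : z' (Fin.castAdd k 0) = X'.1)
    (hz'y : z' (Fin.castAdd k 1) = X'.2) : False := by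
  have h1 := rows_nonneg_of_mem_closure M lo up hz j
  have h2 := rows_nonneg_of_mem_closure M lo up hz' j
  rw [rowval_of_base (M j) X hzx hzy] at h1
  rw [rowval_of_base (M j) X' hz'x hz'y] at h2
  have : (0 : ℝ) ≤ (evq (M j) X : ℝ) * (evq (M j) X' : ℝ) := mul_nonneg h1 h2
  have h3 : ((evq (M j) X * evq (M j) X' : ℚ) : ℝ) < 0 := by exact_mod_cast hj
  push_cast at h3; linarith

/-- **The double cone at a special point** from two rows through it with `y`-coefficients of
opposite signs: the cell lies in `{a₁ (x − X₁) < y − X₂ < b₁ (x − X₁)}`. [folklore] -/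
theorem cone_of_rows {X : ℚ × ℚ} {j j' : Fin m'} (hj : evq (M j) X = 0) (hj' : evq (M j') X = 0)
    (hβ : (M j).1 1 < 0) (hβ' : 0 < (M j').1 1) :
    ∀ z ∈ gDom 1 k m' M lo up,
      ((-(M j').1 0 / (M j').1 1 : ℚ) : ℝ) * (z (Fin.castAdd k 0) - X.1) <
          z (Fin.castAdd k 1) - X.2 ∧
        z (Fin.castAdd k 1) - X.2 <
          ((-(M j).1 0 / (M j).1 1 : ℚ) : ℝ) * (z (Fin.castAdd k 0) - X.1) := by
  intro z hz
  have h1 := hz.1 j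
  have h2 := hz.1 j'
  rw [rowval_sub_pt (M j) X hj] at h1
  rw [rowval_sub_pt (M j') X hj'] at h2
  have hb : ((M j).1 1 : ℝ) < 0 := by exact_mod_cast hβ
  have hb' : (0 : ℝ) < (M j').1 1 := by exact_mod_cast hβ'
  push_cast
  constructor
  · rw [div_mul_eq_mul_div, div_lt_iff₀ hb']; nlinarith
  · rw [div_mul_eq_mul_div, lt_div_iff_of_neg hb]; nlinarith

/-- The only points of the closed cell over the wall `x = X₁` through a special point lie over
the point itself. [folklore] -/
theorem snd_eq_of_mem_closure_of_fst_eq {X : ℚ × ℚ} {j j' : Fin m'} (hj : evq (M j) X = 0)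
    (hj' : evq (M j') X = 0) (hβ : (M j).1 1 < 0) (hβ' : 0 < (M j').1 1)
    {z : Fin (1 + 1 + k) → ℝ} (hz : z ∈ closure (gDom 1 k m' M lo up))
    (hx : z (Fin.castAdd k 0) = X.1) : z (Fin.castAdd k 1) = X.2 := by
  have h1 := rows_nonneg_of_mem_closure M lo up hz j
  have h2 := rows_nonneg_of_mem_closure M lo up hz j'
  rw [rowval_sub_pt (M j) X hj, hx, sub_self, mul_zero, zero_add] at h1
  rw [rowval_sub_pt (M j') X hj', hx, sub_self, mul_zero, zero_add] at h2
  have hb : ((M j).1 1 : ℝ) < 0 := by exact_mod_cast hβ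
  have hb' : (0 : ℝ) < (M j').1 1 := by exact_mod_cast hβ'
  nlinarith

/-- **Harmless walls through far special points**: if `X` is a special point (double cone) not
under the closed bounded cell, then `|x − X₁|` is bounded below on the cell. [folklore] -/
theorem fst_sub_bounded_below {X : ℚ × ℚ} {j j' : Fin m'} (hj : evq (M j) X = 0)
    (hj' : evq (M j') X = 0) (hβ : (M j).1 1 < 0) (hβ' : 0 < (M j').1 1)
    (hbd : Bornology.IsBounded (gDom 1 k m' M lo up))
    (hX : ∀ z ∈ closure (gDom 1 k m' M lo up), z (Fin.castAdd k 0) = X.1 →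
      z (Fin.castAdd k 1) = X.2 → False) :
    ∃ c₀ > 0, ∀ z ∈ gDom 1 k m' M lo up, c₀ ≤ |z (Fin.castAdd k 0) - X.1| := by
  by_cases hne : (closure (gDom 1 k m' M lo up)).Nonempty
  · obtain ⟨z₀, hz₀, hmin⟩ := hbd.isCompact_closure.exists_isMinOn hne
      (f := fun z : Fin (1 + 1 + k) → ℝ => |z (Fin.castAdd k 0) - X.1|) (by fun_prop)
    have hpos : 0 < |z₀ (Fin.castAdd k 0) - X.1| := by
      rw [abs_pos, sub_ne_zero]
      intro h
      exact hX z₀ hz₀ h (snd_eq_of_mem_closure_of_fst_eq M lo up hj hj' hβ hβ' hz₀ h)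
    exact ⟨_, hpos, fun z hz => hmin (subset_closure hz)⟩
  · exact ⟨1, one_pos, fun z hz => absurd ⟨z, subset_closure hz⟩ hne⟩

end Piece

section Letters

variable {k : ℕ}

/-- The crossing point of two non-parallel `y`-letters, and the wall through it. [folklore] -/
theorem exists_cross {c c' : (Fin (1 + 1) → ℚ) × ℚ} (hc : c.1 1 ≠ 0) (hc' : c'.1 1 ≠ 0)
    (hs : (root 1 c).1 0 ≠ (root 1 c').1 0) :
    ∃ X : ℚ × ℚ, evq c X = 0 ∧ evq c' X = 0 ∧ c.1 0 * c'.1 1 ≠ c.1 1 * c'.1 0 ∧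
      ∀ z : Fin (1 + 1 + k) → ℝ, affB 1 k (root 1 c - root 1 c') z =
        (((root 1 c).1 0 - (root 1 c').1 0 : ℚ) : ℝ) * (z (Fin.castAdd k 0) - X.1) := by
  obtain ⟨X, h1, h2, h3, h4⟩ := SepTwoZero.exists_cross hc hc' hs
  refine ⟨X, h1, h2, h3, fun z => ?_⟩
  have h := h4 (fun i => z (Fin.castAdd k i))
  rw [SepTwoZero.affB_eq] at h
  rw [affB_eq]
  exact h

/-- Two distinct letters through `V`: different slopes, and the wall is `(s − s')(x − V₁)`.
[folklore] -/
theorem wall_of_near {c c' : (Fin (1 + 1) → ℚ) × ℚ} {V : ℚ × ℚ}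
    (hn : (root 1 c).1 0 * V.1 + (root 1 c).2 = V.2)
    (hn' : (root 1 c').1 0 * V.1 + (root 1 c').2 = V.2) (hne : root 1 c ≠ root 1 c') :
    (root 1 c).1 0 ≠ (root 1 c').1 0 ∧
      ∀ z : Fin (1 + 1 + k) → ℝ, affB 1 k (root 1 c - root 1 c') z =
        (((root 1 c).1 0 - (root 1 c').1 0 : ℚ) : ℝ) * (z (Fin.castAdd k 0) - V.1) := by
  obtain ⟨hs, h⟩ := SepTwoZero.wall_of_near hn hn' hne
  refine ⟨hs, fun z => ?_⟩
  have h' := h (fun i => z (Fin.castAdd k i))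
  rw [SepTwoZero.affB_eq] at h'
  rw [affB_eq]
  exact h'

/-- Harmlessness of a wall is insensitive to its sign. [folklore] -/
theorem harmless_neg {σ : Set (Fin (1 + 1 + k) → ℝ)} {c c' : (Fin 1 → ℚ) × ℚ}
    (h : ∃ c₀ > 0, ∀ z ∈ σ, c₀ ≤ |affB 1 k (c - c') z|) :
    ∃ c₀ > 0, ∀ z ∈ σ, c₀ ≤ |affB 1 k (c' - c) z| := by
  obtain ⟨c₀, hc₀, hb⟩ := h
  refine ⟨c₀, hc₀, fun z hz => ?_⟩
  rw [affB_sub, abs_sub_comm, ← affB_sub]; exact hb z hz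

/-- A priori bound for `|y − λ(x)|` on a bounded cell. [folklore] -/
theorem abs_sub_affB_le {σ : Set (Fin (1 + 1 + k) → ℝ)} (hσ : Bornology.IsBounded σ)
    (c : (Fin 1 → ℚ) × ℚ) :
    ∃ R, ∀ z ∈ σ, |z (Fin.castAdd k (Fin.last 1)) - affB 1 k c z| ≤ R := by
  obtain ⟨R, hR⟩ := hσ.exists_norm_le
  refine ⟨R + (|(c.1 0 : ℝ)| * R + |(c.2 : ℝ)|), fun z hz => ?_⟩
  have h1 : ∀ j, |z j| ≤ R := fun j =>
    le_trans (by simp [← Real.norm_eq_abs, norm_le_pi_norm]) (hR z hz)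
  have hB : |affB 1 k c z| ≤ |(c.1 0 : ℝ)| * R + |(c.2 : ℝ)| := by
    rw [affB_eq]
    refine (abs_add_le _ _).trans (add_le_add ?_ le_rfl)
    rw [abs_mul]; exact mul_le_mul_of_nonneg_left (h1 _) (abs_nonneg _)
  calc _ ≤ |z (Fin.castAdd k (Fin.last 1))| + |affB 1 k c z| := abs_sub _ _
    _ ≤ _ := add_le_add (h1 _) hB

/-- The ratio condition of a far pair from the harmlessness of its wall. [folklore] -/
theorem ratio_of_harmless {σ : Set (Fin (1 + 1 + k) → ℝ)} (hσ : Bornology.IsBounded σ)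
    {c c' : (Fin 1 → ℚ) × ℚ} (h : ∃ c₀ > 0, ∀ z ∈ σ, c₀ ≤ |affB 1 k (c - c') z|) :
    ∃ C, ∀ z ∈ σ, |z (Fin.castAdd k (Fin.last 1)) - affB 1 k c' z| ≤
      C * |affB 1 k c z - affB 1 k c' z| := by
  obtain ⟨c₀, hc₀, hb⟩ := h
  obtain ⟨R, hR⟩ := abs_sub_affB_le hσ c'
  refine ⟨R / c₀, fun z hz => ?_⟩
  have h1 := hb z hz
  rw [affB_sub] at h1
  have hR0 : 0 ≤ R := (abs_nonneg _).trans (hR z hz)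
  calc _ ≤ R := hR z hz
    _ = R / c₀ * c₀ := by field_simp
    _ ≤ R / c₀ * |affB 1 k c z - affB 1 k c' z| := mul_le_mul_of_nonneg_left h1 (by positivity)

end Letters

end SepTwoPos

open SepTwoPos SeparatePos in
/-- **Harmless walls through far special points, with fibres** (registered part of
`stub_separateTwoPos`; see `SepTwoPos.fst_sub_bounded_below`). [folklore] -/
theorem separateTwoPos_letters (k m' : ℕ) (M : Fin m' → (Fin (1 + 1) → ℚ) × ℚ) (lo up : Fin k → Fin k ⊕ ((Fin (1 + 1) → ℚ) × ℚ)) (X : ℚ × ℚ) (j j' : Fin m') (hj : SepTwoZero.evq (M j) X = 0) (hj' : SepTwoZero.evq (M j') X = 0) (hβ : (M j).1 1 < 0) (hβ' : 0 < (M j').1 1) (hbd : Bornology.IsBounded (SeparatePos.gDom 1 k m' M lo up)) (hX : ∀ z ∈ closure (SeparatePos.gDom 1 k m' M lo up), z (Fin.castAdd k 0) = X.1 → z (Fin.castAdd k 1) = X.2 → False) : ∃ c₀ > 0, ∀ z ∈ SeparatePos.gDom 1 k m' M lo up, c₀ ≤ |z (Fin.castAdd k 0) - X.1| := by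
  exact fst_sub_bounded_below M lo up hj hj' hβ hβ' hbd hX

end Summit.KontsevichZagierPeriods.ArrangementNormalForm.JanusBands
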